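import Summits.Ventures.LatticeQCDFlow.Scoring.SUNTorusBesselSeries
import Summits.Ventures.LatticeQCDFlow.Scoring.UNOnePlaquetteBesselDeterminant
import Summits.Ventures.LatticeQCDFlow.Scoring.SU2HaarClassAngle
import Summits.Ventures.LatticeQCDFlow.Exactness.SpecialTorusCircleChart
import Literature.MathematicalPhysics.QuantumFieldTheory.CircleHaarAngle
import Literature.MathematicalPhysics.QuantumLattice.AbelianMagneticFlux
import HarnessLib

/-!
# The `SU(N)` one-plaquette partition function for EVERY `N`: `∫_{SU(N)} e^{x Re tr U} dU = Σ_{q∈ℤ} det[I_{|q+i−j|}(x)]_{i,j<N}`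

HONEST FRAMING: exact (Metropolis-corrected) sampling algorithms for lattice gauge theory;
figures of merit are autocorrelation/cost numbers at stated couplings and volumes; no
continuum-physics claim.

Venture `LatticeQCDFlow` (cell pub-lqcd), sub-topic `Scoring`; FANOUT row 5 (`s0-sun-a`), GEN-17.
NEW WORK of the cell (placement rule).  Part 2 of the `SU(N)` one-plaquette law for every `N`
(part 1: `SUNTorusBesselSeries.lean`, the eigen-angle integral).  GEN-16 proved the `SU(3)` case on the
Weyl torus and, conditionally on Weyl's formula, on the Haar measure; GEN-9 the `SU(2)` case; here the
Bars–Green series is obtained for ALL `N` directly on the Haar probability measure of `SU(n)`: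

* §1 Haar measure on the maximal torus `SΔ(n)` in the `N − 1` free eigen-phases (row 10's circle chart
  `Exactness/SpecialTorusCircleChart` + `CircleHaarAngle`): for continuous `K`,
  `∫_{SΔ(n)} K(t) dt = (2π)^{−(N−1)} ∫_{(−π,π]^{n∖i₀}} K(diag(e^{iφ(θ)})) dθ`, `φ_{i₀} = −Σθ`;
* §2 the real form of part 1's weighted Vandermonde integral;
* §3 **`∫_{SU(n)} e^{x Re tr U} dU = Σ_{q∈ℤ} det[I_{|q+i−j|}(x)]_{i,j : Fin N}`** for every nonempty finite
  index type `n`, `N = |n|`, and every real `x` (Weyl's integral formula for `SU(n)`, class-function form —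
  the tree's theorem `WeylIntegration.lintegral_haarProbability_specialUnitaryGroup_eq_lintegral_specialDiagonalTorus`
  — then §1, §2); the `Fin N` form; and in theory-2's vocabulary
  **`z₁(fundamentalRep (Fin N), β) = ∫_{SU(N)} e^{−β(N − Re tr U)} dU = e^{−Nβ} Σ_q det[I_{|q+i−j|}(β)]_{N×N}`**
  (`z1_specialUnitary_eq_tsum_det`), of which GEN-16's `z1_su3_eq_tsum_det` is the case `N = 3` and whose
  `N = 2` case is `Σ_q (I_q² − I_{q−1}I_{q+1})(β)`.

Published form: I. Bars, F. Green, Phys. Rev. D 20 (1979) 3311, (1.7); R. Brower, P. Rossi, C.-I. Tan,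
Phys. Rev. D 23 (1981) 942.  No `def`, nothing cited as a fact (Weyl's formula is imported as a proved
theorem), 0 sorry.
-/

noncomputable section

open Real MeasureTheory Finset Complex Equiv
open scoped ENNReal
open Literature.MathematicalPhysics.QuantumFieldTheory
open Literature.MathematicalPhysics.QuantumFieldTheory.CircleHaar (integral_pi_haarProbability_circle)
open Literature.MathematicalPhysics.QuantumLattice
open Literature.Analysis.FunctionSpaces
open Literature.RepresentationTheory.CompactGroups
open Literature.RepresentationTheory.CompactGroups.WeylIntegration
open Literature.LinearAlgebra.Matrix
open Summit.Ventures.LatticeQCDFlow.Exactness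

namespace Summit.Ventures.LatticeQCDFlow.Scoring

variable {n : Type*} [Fintype n] [DecidableEq n] (i₀ : n)

/-! ### 1. Haar measure on `SΔ(n)` in the free eigen-phases -/

/-- The circle chart of `SΔ(n)` at `z = e^{iθ}` is the diagonal matrix `diag(e^{iφ(θ)})`, `φ_{i₀} = −Σθ`. -/
theorem chart_entries_eq_cexp_ext (θ : {i : n // i ≠ i₀} → ℝ) :
    (fun i : n => ((if h : i = i₀ then (∏ j, Circle.exp (θ j))⁻¹ else Circle.exp (θ ⟨i, h⟩) : Circle) : ℂ))
      = fun i : n => cexp (((if h : i = i₀ then -∑ k, θ k else θ ⟨i, h⟩ : ℝ) : ℂ) * I) := by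
  funext i
  by_cases hi : i = i₀
  · simp only [hi, dite_true]
    rw [← circleExp_finset_sum, ← Circle.exp_neg, Circle.coe_exp]
  · simp only [hi, dite_false, Circle.coe_exp]

/-- **Haar integrals over `SΔ(n)` in the free eigen-phases**: for continuous `K` on matrices,
`∫_{SΔ(n)} K(t) dt = (2π)^{−|n∖i₀|} ∫_{(−π,π]^{n∖i₀}} K(diag(e^{iφ(θ)})) dθ` (the circle chart of row 10
pushes `⊗ Haar_{U(1)}` to `Haar_{SΔ(n)}`; `Haar_{U(1)}` is `dθ/2π` on `(−π, π]`). -/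
theorem integral_haar_specialDiagonalTorus_eq_integral_cube (K : Matrix n n ℂ → ℝ) (hK : Continuous K) :
    ∫ t, K (((t : specialDiagonalTorus n) : Matrix.specialUnitaryGroup n ℂ) : Matrix n n ℂ)
        ∂(haarProbability (specialDiagonalTorus n))
      = ((2 * π)⁻¹) ^ Fintype.card {i : n // i ≠ i₀} *
          ∫ θ, K (Matrix.diagonal fun i : n =>
              cexp (((if h : i = i₀ then -∑ k, θ k else θ ⟨i, h⟩ : ℝ) : ℂ) * I))
            ∂(Measure.pi fun _ : {i : n // i ≠ i₀} => (volume : Measure ℝ).restrict (Set.Ioc (-π) π)) := by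
  obtain ⟨schart, hcont, he⟩ := exists_circleChart_specialDiagonalTorus i₀
  have hKc : Continuous fun t : specialDiagonalTorus n =>
      K (((t : Matrix.specialUnitaryGroup n ℂ)) : Matrix n n ℂ) :=
    hK.comp (continuous_subtype_val.comp continuous_subtype_val)
  have hKch : Continuous fun z : {i : n // i ≠ i₀} → Circle =>
      K ((((schart z : specialDiagonalTorus n)) : Matrix.specialUnitaryGroup n ℂ) : Matrix n n ℂ) :=
    hKc.comp hcont
  rw [← map_circleChart_pi_haar_specialDiagonalTorus he,
    integral_map hcont.measurable.aemeasurable hKc.aestronglyMeasurable,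
    integral_pi_haarProbability_circle (fun z : {i : n // i ≠ i₀} → Circle =>
      K ((((schart z : specialDiagonalTorus n)) : Matrix.specialUnitaryGroup n ℂ) : Matrix n n ℂ))
      hKch.aestronglyMeasurable, smul_eq_mul]
  congr 1
  rw [show (volume : Measure ({i : n // i ≠ i₀} → ℝ)).restrict (Set.pi Set.univ fun _ => Set.Ioc (-π) π) =
    Measure.pi fun _ : {i : n // i ≠ i₀} => (volume : Measure ℝ).restrict (Set.Ioc (-π) π) from
      Measure.restrict_pi_pi _ _]
  refine integral_congr_ae (Filter.Eventually.of_forall fun θ => ?_)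
  simp only
  rw [coe_circleChart_specialDiagonalTorus he, chart_entries_eq_cexp_ext]

/-! ### 2. The real form of the weighted Vandermonde integral over the free eigen-phases -/

/-- The real weighted Vandermonde integrand on the free cube is integrable. -/
theorem integrable_cube_exp_mul_sum_cos_mul_prod_norm_sub_sq_ext (x : ℝ) :
    Integrable (fun θ : {i : n // i ≠ i₀} → ℝ =>
      Real.exp (x * ∑ b, Real.cos (if h : b = i₀ then -∑ k, θ k else θ ⟨b, h⟩)) *
        ∏ p : OD n, ‖cexp (((if h : p.1.1 = i₀ then -∑ k, θ k else θ ⟨p.1.1, h⟩ : ℝ) : ℂ) * I) -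
          cexp (((if h : p.1.2 = i₀ then -∑ k, θ k else θ ⟨p.1.2, h⟩ : ℝ) : ℂ) * I)‖ ^ 2)
      (Measure.pi fun _ : {i : n // i ≠ i₀} => (volume : Measure ℝ).restrict (Set.Ioc (-π) π)) := by
  refine Integrable.mono' (integrable_const (Real.exp (|x| * Fintype.card n) * (2 ^ Fintype.card (OD n)) ^ 2))
    ?_ (Filter.Eventually.of_forall fun θ => ?_)
  · refine Continuous.aestronglyMeasurable ((Real.continuous_exp.comp (continuous_const.mul
      (continuous_finsetSum _ fun b _ => Real.continuous_cos.comp (continuous_ext_apply i₀ b)))).mul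
      (continuous_finsetProd _ fun p _ => ?_))
    exact (((Complex.continuous_ofReal.comp (continuous_ext_apply i₀ _)).mul continuous_const).cexp.sub
      ((Complex.continuous_ofReal.comp (continuous_ext_apply i₀ _)).mul continuous_const).cexp).norm.pow 2
  · rw [Real.norm_of_nonneg (mul_nonneg (Real.exp_nonneg _) (Finset.prod_nonneg fun p _ => sq_nonneg _))]
    refine mul_le_mul (Real.exp_le_exp.2 (mul_sum_cos_le x _)) ?_ (Finset.prod_nonneg fun p _ => sq_nonneg _)
      (Real.exp_nonneg _)
    have h := norm_vdm_sq_le (fun i : n => if h : i = i₀ then -∑ k, θ k else θ ⟨i, h⟩)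
    rwa [← prod_OD_norm_sub_sq_eq_norm_vdm_sq] at h

/-- **THE WEIGHTED VANDERMONDE INTEGRAL ON `SΔ(n)`, REAL FORM**:
`∫ e^{x Σ_b cos φ_b} Π_{j≺k}|e^{iφ_j} − e^{iφ_k}|² dθ = (2π)^{N−1} N! Σ_q det[I_{|i−j−q|}(x)]` over the free cube. -/
theorem integral_cube_exp_mul_sum_cos_mul_prod_norm_sub_sq_ext (x : ℝ) :
    ∫ θ, Real.exp (x * ∑ b, Real.cos (if h : b = i₀ then -∑ k, θ k else θ ⟨b, h⟩)) *
        ∏ p : OD n, ‖cexp (((if h : p.1.1 = i₀ then -∑ k, θ k else θ ⟨p.1.1, h⟩ : ℝ) : ℂ) * I) -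
          cexp (((if h : p.1.2 = i₀ then -∑ k, θ k else θ ⟨p.1.2, h⟩ : ℝ) : ℂ) * I)‖ ^ 2
        ∂(Measure.pi fun _ : {i : n // i ≠ i₀} => (volume : Measure ℝ).restrict (Set.Ioc (-π) π))
      = (2 * π) ^ Fintype.card {i : n // i ≠ i₀} * (Fintype.card n).factorial *
          ∑' q : ℤ, (Matrix.of fun i j : n =>
            besselI (((enum n i : ℕ) : ℤ) - ((enum n j : ℕ) : ℤ) - q).natAbs x).det := by
  have hC := integral_cube_prod_cexp_cos_mul_norm_vdm_sq_ext i₀ x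
  have hcomm := Complex.ofRealCLM.integral_comp_comm (integrable_cube_exp_mul_sum_cos_mul_prod_norm_sub_sq_ext i₀ x)
  simp only [Complex.ofRealCLM_apply] at hcomm
  have hfun : ∀ θ : {i : n // i ≠ i₀} → ℝ,
      (((Real.exp (x * ∑ b, Real.cos (if h : b = i₀ then -∑ k, θ k else θ ⟨b, h⟩)) *
        ∏ p : OD n, ‖cexp (((if h : p.1.1 = i₀ then -∑ k, θ k else θ ⟨p.1.1, h⟩ : ℝ) : ℂ) * I) -
          cexp (((if h : p.1.2 = i₀ then -∑ k, θ k else θ ⟨p.1.2, h⟩ : ℝ) : ℂ) * I)‖ ^ 2 : ℝ)) : ℂ)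
      = (∏ b, cexp ((x : ℂ) * Real.cos (if h : b = i₀ then -∑ k, θ k else θ ⟨b, h⟩))) *
          ((‖vdm (fun i : n => if h : i = i₀ then -∑ k, θ k else θ ⟨i, h⟩)‖ ^ 2 : ℝ) : ℂ) := by
    intro θ
    rw [prod_OD_norm_sub_sq_eq_norm_vdm_sq (fun i : n => if h : i = i₀ then -∑ k, θ k else θ ⟨i, h⟩),
      Complex.ofReal_mul, Finset.mul_sum, Real.exp_sum, Complex.ofReal_prod]
    congr 1
    refine Finset.prod_congr rfl fun b _ => ?_
    rw [Complex.ofReal_exp]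
    push_cast
    ring_nf
  simp_rw [hfun] at hcomm
  rw [hcomm] at hC
  have hdet : ∀ q : ℤ, (((Matrix.of fun i j : n =>
      besselI (((enum n i : ℕ) : ℤ) - ((enum n j : ℕ) : ℤ) - q).natAbs x).det : ℝ) : ℂ)
      = (Matrix.of fun i j : n => (besselI (((enum n i : ℕ) : ℤ) - ((enum n j : ℕ) : ℤ) - q).natAbs x : ℂ)).det := by
    intro q
    rw [← Complex.ofRealHom_eq_coe, RingHom.map_det]
    congr 1
  simp_rw [← hdet] at hC
  rw [← Complex.ofReal_tsum] at hC
  exact_mod_cast hC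

/-! ### 3. The Haar side: `∫_{SU(n)} e^{x Re tr U} dU = Σ_{q∈ℤ} det[I_{|q+i−j|}(x)]` -/

/-- `e^{x Re tr U}` is a class function on `SU(n)`: `tr(g U g⁻¹) = tr U`. -/
theorem trace_conj_specialUnitaryGroup (g u : Matrix.specialUnitaryGroup n ℂ) :
    (((g * u * g⁻¹ : Matrix.specialUnitaryGroup n ℂ)) : Matrix n n ℂ).trace
      = ((u : Matrix.specialUnitaryGroup n ℂ) : Matrix n n ℂ).trace := by
  have hg : star (g : Matrix n n ℂ) * (g : Matrix n n ℂ) = 1 :=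
    Matrix.mem_unitaryGroup_iff'.mp (Matrix.specialUnitaryGroup_le_unitaryGroup g.2)
  rw [show (((g * u * g⁻¹ : Matrix.specialUnitaryGroup n ℂ)) : Matrix n n ℂ)
      = (g : Matrix n n ℂ) * (u : Matrix n n ℂ) * star (g : Matrix n n ℂ) from rfl,
    Matrix.trace_mul_cycle, hg, one_mul]

/-- The Weyl density times the weight at a diagonal phase matrix: with `t = diag(e^{iφ})`,
`(Π_iΠ_{j≠i}|t_ii − t_jj| / N!) e^{x Re tr t} = e^{x Σ cos φ} Π_{j≺k}|e^{iφ_j} − e^{iφ_k}|² / N!`. -/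
theorem weylDensity_mul_exp_diagonal (x : ℝ) (φ : n → ℝ) :
    (∏ i, ∏ j ∈ Finset.univ.erase i,
        ‖(Matrix.diagonal fun i : n => cexp ((φ i : ℂ) * I)) i i - (Matrix.diagonal fun i : n => cexp ((φ i : ℂ) * I)) j j‖) /
          (Fintype.card n).factorial *
        Real.exp (x * (Matrix.diagonal fun i : n => cexp ((φ i : ℂ) * I)).trace.re)
      = (Real.exp (x * ∑ b, Real.cos (φ b)) * ∏ p : OD n, ‖cexp (φ p.1.1 * I) - cexp (φ p.1.2 * I)‖ ^ 2) /
          (Fintype.card n).factorial := by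
  rw [← coe_torusPt, prod_offDiag_norm_sub_torusPt, trace_re_torusPt]
  ring

/-- **THE `SU(n)` ONE-PLAQUETTE PARTITION FUNCTION FOR EVERY `n` (Bars–Green / Brower–Rossi–Tan)**:
for every nonempty finite index type `n` with `|n| = N` and every real `x`,
`∫_{SU(n)} e^{x Re tr U} dU = Σ_{q∈ℤ} det[I_{|q+i−j|}(x)]_{i,j < N}` (normalised Haar measure). -/
theorem integral_haar_specialUnitaryGroup_exp_mul_trace_re [Nonempty n] (x : ℝ) :
    ∫ u, Real.exp (x * ((u : Matrix.specialUnitaryGroup n ℂ) : Matrix n n ℂ).trace.re)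
        ∂(haarProbability (Matrix.specialUnitaryGroup n ℂ))
      = ∑' q : ℤ, (Matrix.of fun i j : Fin (Fintype.card n) => besselI (q + (i : ℤ) - (j : ℤ)).natAbs x).det := by
  obtain ⟨i₀⟩ := ‹Nonempty n›
  -- (1) Weyl's integral formula for `SU(n)`, class-function form
  have hc : Continuous fun u : Matrix.specialUnitaryGroup n ℂ =>
      Real.exp (x * ((u : Matrix.specialUnitaryGroup n ℂ) : Matrix n n ℂ).trace.re) :=
    Real.continuous_exp.comp (continuous_const.mul (Complex.continuous_re.comp
      (continuous_id.matrix_trace.comp continuous_subtype_val)))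
  have hF : Measurable fun u : Matrix.specialUnitaryGroup n ℂ =>
      ENNReal.ofReal (Real.exp (x * ((u : Matrix.specialUnitaryGroup n ℂ) : Matrix n n ℂ).trace.re)) :=
    ENNReal.measurable_ofReal.comp hc.measurable
  have hcl : ∀ g u : Matrix.specialUnitaryGroup n ℂ,
      ENNReal.ofReal (Real.exp (x * (((g * u * g⁻¹ : Matrix.specialUnitaryGroup n ℂ)) : Matrix n n ℂ).trace.re))
        = ENNReal.ofReal (Real.exp (x * ((u : Matrix.specialUnitaryGroup n ℂ) : Matrix n n ℂ).trace.re)) := by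
    intro g u
    rw [trace_conj_specialUnitaryGroup]
  -- the real density on the torus
  set H : Matrix n n ℂ → ℝ := fun M =>
    (∏ i, ∏ j ∈ Finset.univ.erase i, ‖M i i - M j j‖) / (Fintype.card n).factorial * Real.exp (x * M.trace.re)
    with hH
  have hHc : Continuous H := by
    refine ((continuous_finsetProd _ fun i _ => continuous_finsetProd _ fun j _ => ?_).div_const _).mul
      (Real.continuous_exp.comp (continuous_const.mul (Complex.continuous_re.comp continuous_id.matrix_trace)))
    exact ((continuous_apply_apply i i).sub (continuous_apply_apply j j)).norm
  have hHnn : ∀ M, 0 ≤ H M := fun M => mul_nonneg (div_nonneg (Finset.prod_nonneg fun i _ =>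
    Finset.prod_nonneg fun j _ => norm_nonneg _) (Nat.cast_nonneg _)) (Real.exp_nonneg _)
  have hW : ∀ t : specialDiagonalTorus n,
      weylWeightSU t * ENNReal.ofReal (Real.exp (x * (((t : Matrix.specialUnitaryGroup n ℂ)) : Matrix n n ℂ).trace.re))
        = ENNReal.ofReal (H (((t : Matrix.specialUnitaryGroup n ℂ)) : Matrix n n ℂ)) := by
    intro t
    rw [weylWeightSU, ← ENNReal.ofReal_mul (div_nonneg (Finset.prod_nonneg fun i _ =>
      Finset.prod_nonneg fun j _ => norm_nonneg _) (Nat.cast_nonneg _))]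
  have hHt : Continuous fun t : specialDiagonalTorus n => H (((t : Matrix.specialUnitaryGroup n ℂ)) : Matrix n n ℂ) :=
    hHc.comp (continuous_subtype_val.comp continuous_subtype_val)
  rw [integral_eq_lintegral_of_nonneg_ae (Filter.Eventually.of_forall fun u => Real.exp_nonneg _)
    hc.aestronglyMeasurable, lintegral_haarProbability_specialUnitaryGroup_eq_lintegral_specialDiagonalTorus hF hcl]
  simp_rw [hW]
  rw [← integral_eq_lintegral_of_nonneg_ae (Filter.Eventually.of_forall fun t => hHnn _) hHt.aestronglyMeasurable,
    integral_haar_specialDiagonalTorus_eq_integral_cube i₀ H hHc]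
  -- (2) the density in angles and part 1
  simp only [hH]
  simp_rw [weylDensity_mul_exp_diagonal]
  rw [integral_div, integral_cube_exp_mul_sum_cos_mul_prod_norm_sub_sq_ext]
  have hπ : (2 * π : ℝ) ≠ 0 := by positivity
  have hN : ((Fintype.card n).factorial : ℝ) ≠ 0 := Nat.cast_ne_zero.2 (Nat.factorial_ne_zero _)
  have key : ((2 * π) ^ Fintype.card {i : n // i ≠ i₀})⁻¹ *
      ((2 * π) ^ Fintype.card {i : n // i ≠ i₀} * (Fintype.card n).factorial *
        (∑' q : ℤ, (Matrix.of fun i j : n => besselI (((enum n i : ℕ) : ℤ) - ((enum n j : ℕ) : ℤ) - q).natAbs x).det) /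
        (Fintype.card n).factorial)
      = ∑' q : ℤ, (Matrix.of fun i j : n => besselI (((enum n i : ℕ) : ℤ) - ((enum n j : ℕ) : ℤ) - q).natAbs x).det := by
    field_simp
  rw [inv_pow, key]
  -- (3) reindex: `n ≃ Fin N` and `q ↦ −q`
  rw [← (Equiv.neg ℤ).tsum_eq]
  refine tsum_congr fun q => ?_
  rw [Equiv.neg_apply, show (Matrix.of fun i j : n => besselI (((enum n i : ℕ) : ℤ) - ((enum n j : ℕ) : ℤ) - -q).natAbs x)
      = (Matrix.of fun i j : Fin (Fintype.card n) => besselI (q + (i : ℤ) - (j : ℤ)).natAbs x).submatrix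
          (enum n) (enum n) from by
        ext i j
        simp only [Matrix.submatrix_apply, Matrix.of_apply]
        rw [show (((enum n i : ℕ) : ℤ) - ((enum n j : ℕ) : ℤ) - -q) = q + ((enum n i : ℕ) : ℤ) - ((enum n j : ℕ) : ℤ) by ring],
    Matrix.det_submatrix_equiv_self]

/-- Reindexing `Fin |Fin N| = Fin N` in the Bars–Green series. -/
theorem tsum_det_besselI_fin_card (N : ℕ) (x : ℝ) :
    ∑' q : ℤ, (Matrix.of fun i j : Fin (Fintype.card (Fin N)) => besselI (q + (i : ℤ) - (j : ℤ)).natAbs x).det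
      = ∑' q : ℤ, (Matrix.of fun i j : Fin N => besselI (q + (i : ℤ) - (j : ℤ)).natAbs x).det := by
  refine tsum_congr fun q => ?_
  rw [show (Matrix.of fun i j : Fin (Fintype.card (Fin N)) => besselI (q + (i : ℤ) - (j : ℤ)).natAbs x)
      = (Matrix.of fun i j : Fin N => besselI (q + (i : ℤ) - (j : ℤ)).natAbs x).submatrix
          (finCongr (Fintype.card_fin N)) (finCongr (Fintype.card_fin N)) from by ext i j; simp,
    Matrix.det_submatrix_equiv_self]

/-- **THE `SU(N)` ONE-PLAQUETTE PARTITION FUNCTION** (Bars–Green 1979 (1.7); Brower–Rossi–Tan 1981):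
for every `N ≥ 1` and real `x`, `∫_{SU(N)} e^{x Re tr U} dU = Σ_{q∈ℤ} det[I_{|q+i−j|}(x)]_{i,j<N}`. -/
theorem integral_haar_specialUnitaryGroup_fin_exp_mul_trace_re (N : ℕ) [NeZero N] (x : ℝ) :
    ∫ u, Real.exp (x * ((u : Matrix.specialUnitaryGroup (Fin N) ℂ) : Matrix (Fin N) (Fin N) ℂ).trace.re)
        ∂(haarProbability (Matrix.specialUnitaryGroup (Fin N) ℂ))
      = ∑' q : ℤ, (Matrix.of fun i j : Fin N => besselI (q + (i : ℤ) - (j : ℤ)).natAbs x).det := by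
  haveI : Nonempty (Fin N) := ⟨0⟩
  rw [integral_haar_specialUnitaryGroup_exp_mul_trace_re, tsum_det_besselI_fin_card]

/-- **theory-2's `SU(N)` ONE-PLAQUETTE INTEGRAL IN CLOSED FORM**: for the Wilson action of the fundamental
representation of `SU(N)`, `N ≥ 1`,
`z₁(β) = ∫_{SU(N)} e^{−β(N − Re tr U)} dU = e^{−Nβ} Σ_{q∈ℤ} det[I_{|q+i−j|}(β)]_{i,j<N}`
(GEN-16's `z1_su3_eq_tsum_det` is the case `N = 3`; by row 30's two-dimensional independence of plaquettes the
2-d `SU(N)` torus free energy density is `−Nβ + log Σ_q det[I_{|q+i−j|}(β)]`). -/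
theorem z1_specialUnitary_eq_tsum_det (N : ℕ) [NeZero N] (β : ℝ) :
    Theory2.Lattice.z1 (fundamentalRep (Fin N)) β
      = ENNReal.ofReal (Real.exp (-(N * β)) *
          ∑' q : ℤ, (Matrix.of fun i j : Fin N => besselI (q + (i : ℤ) - (j : ℤ)).natAbs β).det) := by
  unfold Theory2.Lattice.z1
  simp only [fundamentalRep_apply]
  have hc : Continuous fun u : Matrix.specialUnitaryGroup (Fin N) ℂ =>
      Real.exp (β * ((u : Matrix.specialUnitaryGroup (Fin N) ℂ) : Matrix (Fin N) (Fin N) ℂ).trace.re) :=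
    Real.continuous_exp.comp (continuous_const.mul (Complex.continuous_re.comp
      (continuous_id.matrix_trace.comp continuous_subtype_val)))
  have hint : Integrable (fun u : Matrix.specialUnitaryGroup (Fin N) ℂ =>
      Real.exp (β * ((u : Matrix.specialUnitaryGroup (Fin N) ℂ) : Matrix (Fin N) (Fin N) ℂ).trace.re))
      (haarProbability (Matrix.specialUnitaryGroup (Fin N) ℂ)) := by
    refine Integrable.mono' (integrable_const (Real.exp (|β| * Fintype.card (Fin N)))) hc.aestronglyMeasurable
      (Filter.Eventually.of_forall fun u => ?_)
    rw [Real.norm_of_nonneg (Real.exp_nonneg _)]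
    refine Real.exp_le_exp.2 ?_
    calc β * ((u : Matrix.specialUnitaryGroup (Fin N) ℂ) : Matrix (Fin N) (Fin N) ℂ).trace.re
        ≤ |β * ((u : Matrix.specialUnitaryGroup (Fin N) ℂ) : Matrix (Fin N) (Fin N) ℂ).trace.re| := le_abs_self _
      _ = |β| * |((u : Matrix.specialUnitaryGroup (Fin N) ℂ) : Matrix (Fin N) (Fin N) ℂ).trace.re| := abs_mul _ _
      _ ≤ |β| * Fintype.card (Fin N) := by
          refine mul_le_mul_of_nonneg_left ?_ (abs_nonneg _)
          rw [Matrix.trace, Complex.re_sum]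
          calc |∑ i, (((u : Matrix.specialUnitaryGroup (Fin N) ℂ) : Matrix (Fin N) (Fin N) ℂ) i i).re|
              ≤ ∑ i, |(((u : Matrix.specialUnitaryGroup (Fin N) ℂ) : Matrix (Fin N) (Fin N) ℂ) i i).re| :=
                Finset.abs_sum_le_sum_abs _ _
            _ ≤ ∑ _i : Fin N, (1 : ℝ) := Finset.sum_le_sum fun i _ =>
                (Complex.abs_re_le_norm _).trans (entry_norm_bound_of_unitary
                  (Matrix.specialUnitaryGroup_le_unitaryGroup u.2) i i)
            _ = Fintype.card (Fin N) := by simp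
  have hsplit : ∀ u : Matrix.specialUnitaryGroup (Fin N) ℂ,
      ENNReal.ofReal (Real.exp (-(β * ((N : ℝ) - ((u : Matrix.specialUnitaryGroup (Fin N) ℂ) :
          Matrix (Fin N) (Fin N) ℂ).trace.re))))
        = ENNReal.ofReal (Real.exp (-(N * β))) *
          ENNReal.ofReal (Real.exp (β * ((u : Matrix.specialUnitaryGroup (Fin N) ℂ) :
            Matrix (Fin N) (Fin N) ℂ).trace.re)) := by
    intro u
    rw [← ENNReal.ofReal_mul (Real.exp_nonneg _), ← Real.exp_add]
    congr 2
    ring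
  simp_rw [hsplit]
  rw [lintegral_const_mul' _ _ ENNReal.ofReal_ne_top,
    ← ofReal_integral_eq_lintegral_ofReal hint (Filter.Eventually.of_forall fun u => Real.exp_nonneg _),
    integral_haar_specialUnitaryGroup_fin_exp_mul_trace_re, ← ENNReal.ofReal_mul (Real.exp_nonneg _)]

/-- Sanity check `N = 2`: `∫_{SU(2)} e^{x Re tr U} dU = Σ_{q∈ℤ} (I_{|q|}(x)² − I_{|q−1|}(x) I_{|q+1|}(x))`
(the `2 × 2` Bars–Green determinants; GEN-9's `SU2HaarClassAngle` gives the same integral as `I₁(2x)/x`). -/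
theorem integral_haar_specialUnitaryGroup_two_exp_mul_trace_re (x : ℝ) :
    ∫ u, Real.exp (x * ((u : Matrix.specialUnitaryGroup (Fin 2) ℂ) : Matrix (Fin 2) (Fin 2) ℂ).trace.re)
        ∂(haarProbability (Matrix.specialUnitaryGroup (Fin 2) ℂ))
      = ∑' q : ℤ, (besselI q.natAbs x ^ 2 - besselI (q - 1).natAbs x * besselI (q + 1).natAbs x) := by
  rw [integral_haar_specialUnitaryGroup_fin_exp_mul_trace_re]
  refine tsum_congr fun q => ?_
  rw [Matrix.det_fin_two]
  simp only [Matrix.of_apply, Fin.val_zero, Fin.val_one, Nat.cast_zero, Nat.cast_one, add_zero, sub_zero]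
  rw [show q + 1 - 1 = q by ring]
  ring

/-- **CROSS-CHECK AGAINST GEN-9 (`SU(2)` by the semicircle law)**: GEN-9's `SU2HaarClassAngle` computed
`z₁^{SU(2)}(β) = e^{−2β}(I₀(2β) − I₂(2β))` without Weyl's formula; equating it with the `N = 2` Bars–Green
series of this file proves the Neumann-type addition theorem
`Σ_{q∈ℤ} (I_{|q|}(β)² − I_{|q−1|}(β) I_{|q+1|}(β)) = I₀(2β) − I₂(2β)` (`= I₁(2β)/β` for `β ≠ 0`) for every real `β`
— two independent formalisations of the `SU(2)` one-plaquette integral agree. -/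
theorem tsum_besselI_sq_sub_eq_besselI_two_mul (β : ℝ) :
    ∑' q : ℤ, (besselI q.natAbs β ^ 2 - besselI (q - 1).natAbs β * besselI (q + 1).natAbs β)
      = besselI 0 (2 * β) - besselI 2 (2 * β) := by
  have hS : ∑' q : ℤ, (besselI q.natAbs β ^ 2 - besselI (q - 1).natAbs β * besselI (q + 1).natAbs β)
      = ∑' q : ℤ, (Matrix.of fun i j : Fin 2 => besselI (q + (i : ℤ) - (j : ℤ)).natAbs β).det := by
    rw [← integral_haar_specialUnitaryGroup_two_exp_mul_trace_re, integral_haar_specialUnitaryGroup_fin_exp_mul_trace_re]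
  have hnn : 0 ≤ ∑' q : ℤ, (Matrix.of fun i j : Fin 2 => besselI (q + (i : ℤ) - (j : ℤ)).natAbs β).det := by
    rw [← integral_haar_specialUnitaryGroup_fin_exp_mul_trace_re]
    exact integral_nonneg fun u => (Real.exp_pos _).le
  have h1 := z1_su2_toReal β
  rw [z1_specialUnitary_eq_tsum_det 2 β, ENNReal.toReal_ofReal (mul_nonneg (Real.exp_pos _).le hnn),
    Nat.cast_ofNat] at h1
  rw [hS]
  exact mul_left_cancel₀ (Real.exp_pos (-(2 * β))).ne' h1

end Summit.Ventures.LatticeQCDFlow.Scoring
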